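import Summits.Ventures.YMGap.Census.ZplusMonotone
import HarnessLib

/-!
# Venture YMGap, track (b) — Tomboulis's Prop. IV.2 (ii) for EVERY spin cut-off on every even torus:
# `Z⁺_Λ({c_j}) ≥ (1 + Σ_{j≠0} d_j² c_j⁶)^{L^d/4}`, and (4.11) `Z⁺_Λ ≥ 1`

HONEST FRAMING: venture file of the cell `pub-ymgap` (QuantumFields programme), track (b); finite tori `(ℤ/Lℤ)^d`, `L` even,
`d ≥ 3`; nothing about Tomboulis's (5.15), limits, confinement or a mass gap.

Tomboulis, arXiv:0707.2179, Prop. IV.2 (ii) (eq. (4.10)): `Z⁺_Λ({c_j}) ≥ [1 + Σ_{j≠0} d_j² c_j⁶]^{|Λ|}`, hence (4.11) `Z⁺_Λ > 1`;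
App. A §2 (p. 21): "Take `𝒱 ⊂ Λ_L`, and `𝒱' = R[𝒱] ⊂ Λ_R`. Dropping the terms … coming from all plaquettes bisected by `π₁`, all
of which are non-negative by RP … one may, by a shift of integration variables, move the location of the twist-carrying set `𝒱`
to this boundary and … remove it … The rest of the argument then proceeds exactly as in 1 above."  Kernel form, with the exponent
the App. A §1 argument delivers on every even torus (`HypercubeExponentQuarter`: `L^d/4` link-disjoint equal-parity unit cubes, not
the printed `|Λ|`): run the dropping interpolation of `PatternMonotone` for the PAIR `Z + Z⁻` (`TwistFieldLine`), every marked pair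
being `≥ 0` by transport + `TwistSheet.coefFieldZ_add_twist_transport_nonneg`; the twist sheet is placed (inside its homology class,
`VortexTwistCohomology.torusZtw_vortexSheetAt`) at `(x_0, x_1) = (1, 0)`, where it misses every equal-parity cube, so that after
the dropping both halves equal `(1 + Σ (n+1)² c_n⁶)^{#cubes}` (`CubeFactorization`).

## Main statements (namespace `Summit.Ventures.YMGap.Census`)

* **`torusZplus_lowerBound_quarter`** — `3 ≤ d`, `L` even, every `J`, every plane, admissible `c`:
  `(1 + Σ_{n=1}^{J} (n+1)² c_n⁶)^{L^d/4} ≤ Z⁺_Λ({c_j})` (Prop. IV.2 (ii) with the proof-faithful exponent).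
* `one_le_torusZplus` — (4.11), weak form: `1 ≤ Z⁺_Λ({c_j})`.

References: E. T. Tomboulis, arXiv:0707.2179, Prop. IV.2 (ii) eqs. (4.10)–(4.11), App. A §§1–2 [cite: Tomboulis2007Confinement,
Prop. IV.2, App. A §2]; K. Osterwalder, E. Seiler, Ann. Phys. 110 (1978) 440, §2 [cite: OsterwalderSeilerAnnPhys1978, §2].
-/

noncomputable section

open MeasureTheory Finset Real
open scoped BigOperators
open Literature.MathematicalPhysics.QuantumLattice
open Literature.MathematicalPhysics.QuantumFieldTheory
open Literature.MathematicalPhysics.QuantumFieldTheory.Tomboulis2007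
open Literature.MathematicalPhysics.QuantumFieldTheory.WilsonRP

namespace Summit.Ventures.YMGap.Census

variable {d L : ℕ}

/-! ### The dropping interpolation as an affine line of fields -/

/-- `stdCoef (t c) = oneCoef + t · gCoef c`. -/
theorem stdCoef_scaleCoeff_eq (c : ℕ → ℝ) (t : ℝ) (n : ℕ) :
    stdCoef (scaleCoeff t c) n = oneCoef n + t * gCoef c n := by
  unfold stdCoef scaleCoeff oneCoef gCoef
  split_ifs <;> ring

/-- **The interpolating pattern field is an affine line**: `patternField c S t = A + t B` with `A` the pattern field
(`f_c` on `S`, `1` off `S`) and `B` the dropped part (`0` on `S`, `f_c - 1` off `S`). -/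
theorem patternField_eq_line (c : ℕ → ℝ) (S : Finset (Plaquette d L)) (t : ℝ) :
    patternField c S t = fun p n => basePatternField c S p n + t * (if p ∈ S then (0 : ℕ → ℝ) else gCoef c) n := by
  funext p n
  unfold patternField basePatternField
  by_cases hp : p ∈ S
  · simp [hp]
  · simp only [hp, if_false]
    exact stdCoef_scaleCoeff_eq c t n

/-- At `t = 1` the line is the uniform field: `A + B = stdCoef c` everywhere. -/
theorem basePatternField_add_drop (c : ℕ → ℝ) (S : Finset (Plaquette d L)) :
    (fun p n => basePatternField c S p n + (if p ∈ S then (0 : ℕ → ℝ) else gCoef c) n) = fun _ : Plaquette d L => stdCoef c := by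
  have h := patternField_eq_line c S 1
  have h1 : patternField c S 1 = fun _ : Plaquette d L => stdCoef c := by
    funext p; simp only [patternField, scaleCoeff_one, ite_self]
  rw [h1] at h
  rw [h]
  funext p n
  ring

/-! ### The marked pair along the dropping interpolation -/

section Marked

variable [NeZero d] [NeZero L] [Fact (1 < L)]

/-- **Every marked pair of the dropping interpolation is non-negative** (`t ≥ 0`, `c_j ≥ 0`, `S` reflection-transportable, twist
on any translated `(0,1)`-sheet): `0 ≤ Z(markedField) + Z(markedField⁻)`.  On `S` the marked factor vanishes; off `S` the marked
plaquette is transported onto the reflection hyperplane, where the transported pattern field is mirror-symmetric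
(`IsReflTransportable`) and the transported twist set is a translated sheet (`coefFieldZ_add_twist_transport_nonneg`). -/
theorem coefFieldZ_add_twist_markedField_nonneg (hL : Even L) (h01 : (0 : Fin d) < 1) (J : ℕ) {c : ℕ → ℝ}
    (hc : ∀ n, 1 ≤ n → 0 ≤ c n) {S : Finset (Plaquette d L)} (hS : IsReflTransportable S) {t : ℝ} (ht : 0 ≤ t)
    (a b : ZMod L) (p₀ : Plaquette d L) :
    0 ≤ coefFieldZ J (markedField c S t p₀) + coefFieldZ J (twistField (sheetAt 0 1 h01 a b) (markedField c S t p₀)) := by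
  by_cases hp₀ : p₀ ∈ S
  · have hz : markedField c S t p₀ p₀ = 0 := by simp [markedField, hp₀]
    have hz' : twistField (sheetAt 0 1 h01 a b) (markedField c S t p₀) p₀ = 0 := by
      by_cases hV : p₀ ∈ sheetAt 0 1 h01 a b
      · rw [twistField_of_mem hV, hz]
        funext n
        simp [twistVec]
      · rw [twistField_of_not_mem hV, hz]
    rw [coefFieldZ_eq_zero_of_apply_eq_zero J hz, coefFieldZ_eq_zero_of_apply_eq_zero J hz', add_zero]
  obtain ⟨μ, v, hcross, hrefl⟩ := hS p₀
  rw [coefFieldZ_transport J (markedField c S t p₀) μ v,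
    coefFieldZ_transport J (twistField (sheetAt 0 1 h01 a b) (markedField c S t p₀)) μ v, twistField_comp]
  -- non-negativity of all coefficient vectors involved
  have hstd : ∀ n, 0 ≤ stdCoef c n := stdCoef_nonneg hc
  have hstdt : ∀ n, 0 ≤ stdCoef (scaleCoeff t c) n := stdCoef_nonneg fun n hn => mul_nonneg ht (hc n hn)
  have hpat : ∀ q n, 0 ≤ patternField c S t q n := fun q n => by
    unfold patternField; split_ifs; exacts [hstd n, hstdt n]
  have hmk : ∀ q n, 0 ≤ markedField c S t p₀ q n := fun q n => by
    unfold markedField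
    by_cases hq : q = p₀
    · subst hq; rw [Function.update_self, if_neg hp₀]; exact gCoef_nonneg hc n
    · rw [Function.update_of_ne hq]; exact hpat q n
  -- the inverse transport hits `p₀` only at the crossing plaquette `σ p₀`
  have hinv : ∀ q : Plaquette d L, plaqTranspose 0 μ (plaqShift (-v) q) = p₀ →
      q = plaqShift v (plaqTranspose 0 μ p₀) := fun q h => by
    rw [← h, plaqTranspose_plaqTranspose', plaqShift_plaqShift_neg]
  refine coefFieldZ_add_twist_transport_nonneg hL J (fun q hq => ?_) (fun q _ n => hmk _ n) h01 μ v a b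
  have hq' : ¬ IsCrossPlaq (plaqReflect q) := not_isCrossPlaq_plaqReflect hL hq
  have hne : plaqTranspose 0 μ (plaqShift (-v) q) ≠ p₀ := fun h => hq (by rw [hinv q h]; exact hcross)
  have hne' : plaqTranspose 0 μ (plaqShift (-v) (plaqReflect q)) ≠ p₀ := fun h =>
    hq' (by rw [hinv _ h]; exact hcross)
  simp only [markedField, Function.update_of_ne hne, Function.update_of_ne hne', patternField, hrefl q]

/-- **Dropping the plaquettes outside a reflection-transportable pattern does not increase `Z + Z⁻`** (twist on any translated
`(0,1)`-sheet): `Z(A) + Z(A⁻) ≤ Z_Λ({c_j}) + Z⁻_Λ({c_j})`, `A` the pattern field. -/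
theorem coefFieldZ_pattern_add_twist_le (hL : Even L) (h01 : (0 : Fin d) < 1) (J : ℕ) {c : ℕ → ℝ}
    (hc : ∀ n, 1 ≤ n → 0 ≤ c n) {S : Finset (Plaquette d L)} (hS : IsReflTransportable S) (a b : ZMod L) :
    coefFieldZ J (basePatternField c S) + coefFieldZ J (twistField (sheetAt 0 1 h01 a b) (basePatternField c S)) ≤
      coefFieldZ J (fun _ : Plaquette d L => stdCoef c) +
        coefFieldZ J (twistField (sheetAt 0 1 h01 a b) fun _ : Plaquette d L => stdCoef c) := by
  set V := sheetAt (L := L) 0 1 h01 a b with hV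
  obtain ⟨B, hB⟩ : ∃ B : Plaquette d L → ℕ → ℝ, B = fun p => if p ∈ S then (0 : ℕ → ℝ) else gCoef c := ⟨_, rfl⟩
  have hline : ∀ t : ℝ, patternField c S t = fun p n => basePatternField c S p n + t * B p n := fun t => by
    rw [hB]; exact patternField_eq_line c S t
  have hmarked : ∀ (t : ℝ) (p₀ : Plaquette d L),
      markedField c S t p₀ = Function.update (fun p n => basePatternField c S p n + t * B p n) p₀ (B p₀) := fun t p₀ => by
    unfold markedField
    rw [hline t, hB]
  have h1 : (fun p n => basePatternField c S p n + B p n) = fun _ : Plaquette d L => stdCoef c := by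
    rw [hB]; exact basePatternField_add_drop c S
  have key := coefFieldZ_add_le_of_marked_nonneg J (basePatternField c S) B (twistField V (basePatternField c S))
    (twistField V B) fun t ht p₀ => by
      have hB' : twistField V B p₀ = twistField V (fun _ : Plaquette d L => B p₀) p₀ := rfl
      rw [← twistField_line, hB', ← twistField_update, ← hmarked]
      exact coefFieldZ_add_twist_markedField_nonneg hL h01 J hc hS ht.le a b p₀
  rw [← twistField_add', h1] at key
  exact key

end Marked

/-! ### The twist sheet at `(x_0, x_1) = (1, 0)` misses the equal-parity cube pattern -/

section Sheet

variable [NeZero d] [NeZero L]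

omit [NeZero d] [NeZero L] in
/-- The parity of the coordinate `1 : ZMod L` is `1` and of `0` is `0` (`L` even). -/
theorem sitePar_apply_eq (hL : Even L) (x : Site d L) (m : Fin d) :
    (x m = 1 → sitePar x m = 1) ∧ (x m = 0 → sitePar x m = 0) := by
  refine ⟨fun h => ?_, fun h => ?_⟩
  · simp only [sitePar, h]
    exact ZMod.cast_one (even_iff_two_dvd.mp hL)
  · simp only [sitePar, h, ZMod.cast_zero]

/-- **The sheet `sheet_{01}(1, 0)` contains no face of an equal-parity cube with directions `{0, 1, k}`** (its plaquettes have
base parities `(1, 0, …)`, unequal in the directions `0` and `1`). -/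
theorem sheetAt_one_zero_disjoint_cubePattern (hL : Even L) (h01 : (0 : Fin d) < 1) {k : Fin d} (h1k : (1 : Fin d) < k)
    {p : Plaquette d L} (hp : p ∈ sheetAt 0 1 h01 1 0) : p ∉ cubePattern (dirs3 0 1 k) (parClass 0 1 k) := by
  intro hS
  obtain ⟨h2, hx0, hx1⟩ := (mem_sheetAt h01 1 0 p).1 hp
  have hpar0 : sitePar p.1 0 = 1 := (sitePar_apply_eq hL p.1 0).1 hx0
  have hpar1 : sitePar p.1 1 = 0 := (sitePar_apply_eq hL p.1 1).2 hx1
  have hk0 : k ≠ 0 := (h01.trans h1k).ne'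
  have hk1 : k ≠ 1 := h1k.ne'
  obtain ⟨-, -, m, hmD, hm1, hm2, hpar⟩ := mem_cubePattern.1 hS
  have hp1 : p.2.1.1 = 0 := by rw [h2]
  have hp2 : p.2.1.2 = 1 := by rw [h2]
  rw [hp1] at hm1
  rw [hp2] at hm2
  have hne : (1 : ZMod 2) ≠ 0 := by decide
  rcases hpar with h | h
  · have h' := (mem_parClass.1 h).1
    rw [hpar0, hpar1] at h'
    exact hne h'
  · have h' := (mem_parClass.1 h).1
    simp only [Pi.add_apply, Pi.single_apply, if_false, add_zero, Ne.symm hm1, Ne.symm hm2] at h'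
    rw [hpar0, hpar1] at h'
    exact hne h'

/-- Hence **twisting on `sheet_{01}(1, 0)` does not change the pattern field** of the equal-parity cubes: off the pattern the
weight is `1` (`oneCoef`), which has no half-integer part. -/
theorem twistField_sheetAt_basePatternField (hL : Even L) (h01 : (0 : Fin d) < 1) {k : Fin d} (h1k : (1 : Fin d) < k)
    (c : ℕ → ℝ) :
    twistField (sheetAt 0 1 h01 1 0) (basePatternField c (cubePattern (dirs3 0 1 k) (parClass 0 1 k))) =
      basePatternField c (cubePattern (L := L) (dirs3 0 1 k) (parClass 0 1 k)) := by
  funext p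
  by_cases hp : p ∈ sheetAt 0 1 h01 1 0
  · rw [twistField_of_mem hp]
    have hpS := sheetAt_one_zero_disjoint_cubePattern hL h01 h1k hp
    simp only [basePatternField, hpS, if_false]
    funext n
    unfold twistVec oneCoef
    split_ifs with hn
    · subst hn; simp
    · simp
  · rw [twistField_of_not_mem hp]

end Sheet

/-! ### Prop. IV.2 (ii) with exponent `L^d / 4`, and (4.11) -/

/-- **Prop. IV.2 (ii) in the `(0,1)` plane**: `(1 + Σ (n+1)² c_n⁶)^{L^d/4} ≤ Z⁺_Λ({c_j}; 𝒱_{01})` (`d ≥ 3`, `L` even). -/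
theorem torusZplus_lowerBound_zero_one (hd : 3 ≤ d) [NeZero d] [NeZero L] (hL : Even L) (J : ℕ) (h01 : (0 : Fin d) < 1)
    {c : ℕ → ℝ} (hc : CoeffAdmissible c) :
    (1 + ∑ n ∈ Icc 1 J, ((n : ℝ) + 1) ^ 2 * c n ^ 6) ^ (L ^ d / 4) ≤ torusZplus d L J c (vortexSheet L 0 1 h01) := by
  have hL1 : 1 < L := by
    have h0 : L ≠ 0 := NeZero.ne L
    obtain ⟨m, hm⟩ := hL
    omega
  haveI : Fact (1 < L) := ⟨hL1⟩
  have hc' : ∀ n, 1 ≤ n → 0 ≤ c n := fun n hn => (hc n hn).1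
  -- the third direction and the cube pattern
  have hv1 : (1 : Fin d).val = 1 := by
    rw [Fin.val_one', Nat.one_mod_eq_one.mpr (by omega)]
  have h1k : (1 : Fin d) < ⟨2, by omega⟩ := by
    rw [Fin.lt_def, hv1]
    norm_num
  have hS := isReflTransportable_cubePattern (L := L) hL h01 h1k
  -- move the sheet to `(x_0, x_1) = (1, 0)` and pass to fields
  have hZtw : torusZtw d L J c (vortexSheet L 0 1 h01) =
      coefFieldZ J (twistField (sheetAt 0 1 h01 1 0) fun _ : Plaquette d L => stdCoef c) := by
    rw [← torusZtw_vortexSheetAt L J c 1 h01, ← sheetAt_zero_right, torusZtw_eq_coefFieldZ_twistField]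
  have hZ : torusZ d L J c = coefFieldZ J (fun _ : Plaquette d L => stdCoef c) := torusZ_eq_coefFieldZ J c
  -- the dropping inequality for the pair and the value after dropping
  have key := coefFieldZ_pattern_add_twist_le hL h01 J hc' hS 1 0
  rw [twistField_sheetAt_basePatternField hL h01 h1k, coefFieldZ_basePatternField_cubePattern hL J c h01 h1k,
    card_cubeBases hL h01.ne (h01.trans h1k).ne h1k.ne, ← hZ, ← hZtw] at key
  unfold torusZplus
  linarith

/-- **Tomboulis's Prop. IV.2 (ii) (arXiv:0707.2179 eq. (4.10)) with the exponent its App. A proof delivers, for every spin cut-off,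
on every even torus, every plane**: for `Λ = (ℤ/Lℤ)^d` with `L` even, `d ≥ 3`, every `J` and all admissible coefficients
`0 ≤ c_j ≤ 1` (only `0 ≤ c_j` is used), `Z⁺_Λ({c_j}) ≥ (1 + Σ_{j≠0} d_j² c_j⁶)^{L^d/4}` with `Z⁺ = (Z + Z⁻)/2` and the twist on
Tomboulis's vortex sheet `𝒱_{ij}`.  (As printed the exponent is `|Λ|`; see `HypercubeLowerBoundExp` / `HypercubeExponentQuarter` for
the exponent question, cell item C2.) -/
theorem torusZplus_lowerBound_quarter (hd : 3 ≤ d) [NeZero L] (hL : Even L) (J : ℕ) {i j : Fin d} (hij : i < j)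
    {c : ℕ → ℝ} (hc : CoeffAdmissible c) :
    (1 + ∑ n ∈ Icc 1 J, ((n : ℝ) + 1) ^ 2 * c n ^ 6) ^ (L ^ d / 4) ≤ torusZplus d L J c (vortexSheet L i j hij) := by
  haveI : NeZero d := ⟨by omega⟩
  have h01 : (0 : Fin d) < 1 := by
    rw [Fin.lt_def, Fin.val_zero, Fin.val_one', Nat.one_mod_eq_one.mpr (by omega)]
    exact Nat.one_pos
  have h : torusZplus d L J c (vortexSheet L i j hij) = torusZplus d L J c (vortexSheet L 0 1 h01) := by
    unfold torusZplus
    rw [torusZtw_vortexSheet_eq_plane_zero_one h01 hij]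
  rw [h]
  exact torusZplus_lowerBound_zero_one hd hL J h01 hc

/-- **(4.11), weak form**: `1 ≤ Z⁺_Λ({c_j})` on every even torus, `d ≥ 3`, every `J`, every plane, admissible `c`. -/
theorem one_le_torusZplus (hd : 3 ≤ d) [NeZero L] (hL : Even L) (J : ℕ) {i j : Fin d} (hij : i < j) {c : ℕ → ℝ}
    (hc : CoeffAdmissible c) : 1 ≤ torusZplus d L J c (vortexSheet L i j hij) := by
  refine le_trans ?_ (torusZplus_lowerBound_quarter hd hL J hij hc)
  refine one_le_pow₀ ?_
  have hs : 0 ≤ ∑ n ∈ Icc 1 J, ((n : ℝ) + 1) ^ 2 * c n ^ 6 :=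
    Finset.sum_nonneg fun n hn => mul_nonneg (by positivity) (pow_nonneg (hc n (Finset.mem_Icc.1 hn).1).1 6)
  linarith

/-- And the twisted partition function alone: **`Z⁻_Λ({c_j}) ≥ 2 (1 + Σ (n+1)² c_n⁶)^{L^d/4} - Z_Λ({c_j})`** — the form in which the
pair bound constrains the vortex free energy on a finite even torus. -/
theorem torusZtw_ge_two_mul_pow_sub (hd : 3 ≤ d) [NeZero L] (hL : Even L) (J : ℕ) {i j : Fin d} (hij : i < j)
    {c : ℕ → ℝ} (hc : CoeffAdmissible c) :
    2 * (1 + ∑ n ∈ Icc 1 J, ((n : ℝ) + 1) ^ 2 * c n ^ 6) ^ (L ^ d / 4) - torusZ d L J c ≤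
      torusZtw d L J c (vortexSheet L i j hij) := by
  have h := torusZplus_lowerBound_quarter hd hL J hij hc
  unfold torusZplus at h
  linarith

end Summit.Ventures.YMGap.Census

end
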